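import Summits.MatrixMultiplication.MatrixMultiplication.Theorems.EdgePencilHalfFloor
import Summits.MatrixMultiplication.MatrixMultiplication.Theorems.EdgePencilPairing
import Literature.Computability.AlgebraicComplexity.MatMulM22RankLowerBound
import HarnessLib

/-!
# The half-tensor `X_N^{(e,d)}`: grouping floor `R(⟨N, d, eN⟩) ≤ R₄(X)`, mirror equality
# `R₄(σX) = R₄(X)`, and the bottom admissible level `(N,e,d) = (2,2,2)` of the σ-pair

Support kernel for `stmt-MatrixMultiplication-26697` (`TetraExcessZero : ω(K₄) ≤ ω(2,1,2)`, the
attacked leaf of route `TetrahedronCarving`; lineage `decomp-mm-lens-6` «barrier-complement carving»,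
generation 32, memo NODE-g32 §2). It prices, in proved currency, the writer's instrument ask
(decomp-mm STATUS l.1466 (3)): «at the smallest admissible level `(N, e, d)` compute
`R₄(X ⊠ σX)` against `R₄(X)·R₄(σX)`» — here `X = halfTetra F N e d` is the half-tensor of
`EdgePencilHalfTetra` (triangle `023` at bonds `02 = 03 = N`, `23 = d`, pendant `01` at bond `e`),
`σX = halfTetraMirror F N e d` its mirror, and the pairing of `EdgePencilPairing` is
`R₄(W_N^{(e²)}) ≤ R₄(X)·R₄(σX)` for `e ≤ N`, `d ≤ N ≤ d²` (`W = sixTetra`). No item is added or changed.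

CONTENTS.
* §1 `R₄(σX) = R₄(X)` (`tensorRankD_halfTetraMirror_eq`): the mirror leg map is an involution
  (`mirrorPull_mirrorPull`), so `X` is also the pullback of `σX` (`halfTetra_eq_pullback_mirror`) and
  the inequality `R₄(σX) ≤ R₄(X)` of `EdgePencilHalfTetra` reverses. Hence the pairing comparator is
  `R₄(X)²` exactly, not only as an upper bound.
* §2 GROUPING FLOOR (`tensorRank_matMulTensor_le_tensorRankD_halfTetra`): merging the parties `1, 2`
  of `X_N^{(e,d)}` (`e, d ≤ N`) gives the rectangular matrix multiplication tensor `⟨N, d, eN⟩`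
  (Bläser's convention `matMulTensor F k m n`, bonds `k = N` on edge `03`, `m = d` on edge `23`,
  `n = e·N` on the merged edge `{01, 02}`), and a 4-party rank-one decomposition restricts along
  the points of `halfTetra_groupPoint` to a triad decomposition: `R(⟨N, d, eN⟩) ≤ R₄(X_N^{(e,d)})`; with the tree's
  Lafon–Winograd bound, `N·d + d(eN − 1) + (eN − 1) ≤ R₄(X)` (`lafonWinograd_le_tensorRankD_halfTetra`).
  Every rank lower bound for rectangular matrix multiplication now transfers to `X` — the floor the
  instrument needs at finite levels (the party-`0` flattening floor `N²e ≤ R₄(X)` of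
  `EdgePencilHalfFloor` is the `Z`-flattening of the same `⟨N, d, eN⟩`).
* §3 THE BOTTOM ADMISSIBLE LEVEL `(2,2,2)` (smallest `(N,e,d)` with `1 < e ≤ N`, `d ≤ N ≤ d²`):
  `13 ≤ R₄(X_2^{(2,2)})` over every field (`thirteen_le_tensorRankD_halfTetra_two`, from the tree's
  PROVED Lafon–Winograd bound `13 ≤ R(⟨2,2,4⟩)`), `14 ≤ R₄(X_2^{(2,2)})` given the tree's named fact
  `alekseev2015_rank_matMulTensor_m22_ge` (`fourteen_le_tensorRankD_halfTetra_two_of_alekseev`, via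
  `R(⟨2,2,4⟩) = 14`, Alekseev–Smirnov 2013), and RESTRICTED-PAIR STRICTNESS AS A THEOREM
  (`restrictedPair_strict_two`): `R₄(W_2^{(4)}) = R₄(T(K₄)_2) ≤ 64 < 169 ≤ R₄(X)·R₄(σX)`. So at the
  bottom level the pairing inequality is ALREADY strict by a factor `> 2.6` for trivial reasons (the
  pendant bond `e² = 4` exceeds the level `N = 2` and saturates) — which is why the memo prices the
  instrument as exponent-uninformative at constant levels: the rung needs a saving growing like `N^δ`
  along the square levels `N = m²`, `e = ⌈m^δ⌉`, `d = m` of `EdgePencilPairing` §3b, not a constant one.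
  (Informal complement, not used here: `R₄(X_2^{(2,2)}) ≤ 2·R(⟨2,2,2⟩) = 14` by Strassen on the
  triangle times the pendant basis, so `R₄(X_2^{(2,2)}) = 14` given Alekseev; the FULL pair
  `X ⊠ σX = K₄(4,2,2,2,2,4) ∈ (F^16)^{⊗4}` has `R₄ ≤ 196`, and full-pair strictness at this level is
  the numerical question `R₄(X ⊠ σX) ≤ 195` of instrument I-L6g32a.)

References: Christandl–Vrana–Zuiddam [ChristandlVranaZuiddam2016] (arXiv:1609.07476) §1.1–1.2
(graph tensors, grouping / flattening lower bounds, Prop. 1.1.16); Bürgisser–Clausen–Shokrollahi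
[BurgisserClausenShokrollahi1997] Thm. (17.12) (Lafon–Winograd) and Rem. (17.13)(3); Alekseev 2015
Thm 1 [Alekseev2015ChebyshevM22] and Alekseev–Smirnov 2013 [AlekseevSmirnov2013] (`R(⟨2,2,4⟩) = 14`,
tree file `MatMulM22RankLowerBound`). No `sorry`, no new axiom, no instance, no notation.
-/

noncomputable section

set_option linter.dupNamespace false

open Finset Literature.Computability.AlgebraicComplexity
open Summit.MatrixMultiplication.MatrixMultiplication.Theorems.TetrahedronTensor
open Summit.MatrixMultiplication.MatrixMultiplication.Theorems.TetraDiagonal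

namespace Summit.MatrixMultiplication.MatrixMultiplication.Theorems.EdgePencil

/-! ## §1 Mirror equality `R₄(σX) = R₄(X)` -/

section MirrorEq

variable {F : Type*} [Field F]

/-- Swapping the slots `0, 1` twice is the identity. -/
theorem slotSwap_slotSwap {N : ℕ} (x : Fin (N ^ 3)) : slotSwap (slotSwap x) = x := by
  apply finFunctionFinEquiv.symm.injective
  funext j
  rw [symm_slotSwap, symm_slotSwap, Equiv.swap_apply_self]

/-- The mirror leg map is an involution. -/
theorem mirrorPull_mirrorPull {N : ℕ} (i : Fin 4 → Fin (N ^ 3)) : mirrorPull (mirrorPull i) = i := by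
  funext v
  fin_cases v
  · rfl
  · rfl
  · exact slotSwap_slotSwap (i 2)
  · exact slotSwap_slotSwap (i 3)

/-- **`X = σX ∘ mirror`**: the half-tensor is the pullback of its mirror (the mirror is an
involution and `σX = X ∘ mirror`, `halfTetraMirror_eq_pullback`). [folklore] -/
theorem halfTetra_eq_pullback_mirror (N e d : ℕ) :
    halfTetra F N e d = fun i => halfTetraMirror F N e d (mirrorPull i) := by
  funext i
  rw [halfTetraMirror_eq_pullback (F := F) N e d]
  simp only [mirrorPull_mirrorPull]

/-- A decomposition of `X` of length `R₄(σX)`: the legs of an optimal decomposition of `σX`,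
permuted by the mirror. [folklore] -/
theorem exists_rankOne_decomposition_halfTetra_of_mirror (N e d : ℕ) :
    ∃ u : Fin (tensorRankD (halfTetraMirror F N e d)) → Fin 4 → Fin (N ^ 3) → F,
      ∑ k, rankOneTensor (u k) = halfTetra F N e d := by
  classical
  obtain ⟨u, hu⟩ := exists_rankOne_decomposition_halfTetraMirror (F := F) N e d
  refine ⟨fun k => ![u k 1, u k 0, fun x => u k 2 (slotSwap x), fun x => u k 3 (slotSwap x)], ?_⟩
  funext i
  have hi := congrFun hu (mirrorPull i)
  rw [Finset.sum_apply] at hi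
  have hp : halfTetra F N e d i = halfTetraMirror F N e d (mirrorPull i) :=
    congrFun (halfTetra_eq_pullback_mirror (F := F) N e d) i
  rw [Finset.sum_apply, hp, ← hi]
  refine Finset.sum_congr rfl fun k _ => ?_
  simp only [rankOneTensor_apply, Fin.prod_univ_four, mirrorPull, Matrix.cons_val_zero,
    Matrix.cons_val_one, Matrix.cons_val_two, Matrix.cons_val_three, Matrix.head_cons,
    Matrix.tail_cons]
  ring

/-- `R₄(X) ≤ R₄(σX)`. [folklore] -/
theorem tensorRankD_halfTetra_le_mirror (N e d : ℕ) :
    tensorRankD (halfTetra F N e d) ≤ tensorRankD (halfTetraMirror F N e d) := by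
  obtain ⟨u, hu⟩ := exists_rankOne_decomposition_halfTetra_of_mirror (F := F) N e d
  exact tensorRankD_le_of_eq_sum u hu

/-- **`R₄(σX) = R₄(X)`**: the mirror is a relabelling both ways. [folklore] -/
theorem tensorRankD_halfTetraMirror_eq (N e d : ℕ) :
    tensorRankD (halfTetraMirror F N e d) = tensorRankD (halfTetra F N e d) :=
  le_antisymm (tensorRankD_halfTetraMirror_le N e d) (tensorRankD_halfTetra_le_mirror N e d)

/-- The pairing comparator is a square: `R₄(X)·R₄(σX) = R₄(X)²`. [folklore] -/
theorem tensorRankD_halfTetra_mul_mirror (N e d : ℕ) :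
    tensorRankD (halfTetra F N e d) * tensorRankD (halfTetraMirror F N e d) =
      tensorRankD (halfTetra F N e d) ^ 2 := by
  rw [tensorRankD_halfTetraMirror_eq, sq]

end MirrorEq

/-! ## §2 Grouping the parties `1, 2`: `R(⟨N, d, eN⟩) ≤ R₄(X_N^{(e,d)})` -/

section Grouping

variable {F : Type*} [Field F]

/-- **The grouped half-tensor is `⟨N, d, eN⟩`.** Read a point `(a, b, c)` of `⟨N, d, eN⟩`
(`a = (κ, ν)`, `b = (κ', μ)`, `c = (μ', ν')`; `κ ∈ [N]` the label of edge `03`, `μ ∈ [d]` the label of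
edge `23`, `ν = (ℓ, x) ∈ [e] × [N]` the labels of the pendant `01` and of edge `02`; party `A` of
`⟨N,d,eN⟩` is vertex `0`, party `B` is vertex `3`, party `C` is the merged pair `{1, 2}`) as the leg
indices: vertex `0 ↦ (ℓ, x, κ)`, vertex `1 ↦ (ℓ', 0, 0)`, vertex `2 ↦ (x', 0, μ')`, vertex `3 ↦ (κ', 0, μ)`
(deleted edges `12, 13` frozen to label `0`); there `X_N^{(e,d)}` takes the value `⟨N, d, eN⟩(a, b, c)`.
[folklore] -/
theorem halfTetra_groupPoint {N e d : ℕ} [NeZero N] (he : e ≤ N) (hd : d ≤ N)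
    (a : Fin N × Fin (e * N)) (b : Fin N × Fin d) (c : Fin d × Fin (e * N)) :
    halfTetra F N e d
        ![enc (Fin.castLE he (finProdFinEquiv.symm a.2).1) (finProdFinEquiv.symm a.2).2 a.1,
          enc (Fin.castLE he (finProdFinEquiv.symm c.2).1) 0 0,
          enc (finProdFinEquiv.symm c.2).2 0 (Fin.castLE hd c.1),
          enc b.1 0 (Fin.castLE hd b.2)] = matMulTensor F N d (e * N) a b c := by
  have ecast : ∀ {m : ℕ} (h : m ≤ N) (x y : Fin m), (Fin.castLE h x = Fin.castLE h y ↔ x = y) :=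
    fun h x y => (Fin.castLE_injective h).eq_iff
  have e2 : ∀ x y : Fin (e * N), x = y ↔
      ((finProdFinEquiv.symm x).1 = (finProdFinEquiv.symm y).1 ∧
        (finProdFinEquiv.symm x).2 = (finProdFinEquiv.symm y).2) := fun x y => by
    rw [← Prod.ext_iff, Equiv.apply_eq_iff_eq]
  have e3 : (c.1 = b.2 ↔ b.2 = c.1) := eq_comm
  have hlt : ∀ {m : ℕ} (h : m ≤ N) (x : Fin m), ((Fin.castLE h x : Fin N) : ℕ) < m := fun h x => by
    rw [Fin.val_castLE]; exact x.is_lt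
  have h1 : ((0 : Fin N) : ℕ) < 1 := by simp
  -- the point in the form of `halfTetra_apply_enc`
  have hpt : (![enc (Fin.castLE he (finProdFinEquiv.symm a.2).1) (finProdFinEquiv.symm a.2).2 a.1,
        enc (Fin.castLE he (finProdFinEquiv.symm c.2).1) 0 0,
        enc (finProdFinEquiv.symm c.2).2 0 (Fin.castLE hd c.1),
        enc b.1 0 (Fin.castLE hd b.2)] : Fin 4 → Fin (N ^ 3)) =
      fun v => enc
        (![![Fin.castLE he (finProdFinEquiv.symm a.2).1, (finProdFinEquiv.symm a.2).2, a.1],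
            ![Fin.castLE he (finProdFinEquiv.symm c.2).1, 0, 0],
            ![(finProdFinEquiv.symm c.2).2, 0, Fin.castLE hd c.1],
            ![b.1, 0, Fin.castLE hd b.2]] v 0)
        (![![Fin.castLE he (finProdFinEquiv.symm a.2).1, (finProdFinEquiv.symm a.2).2, a.1],
            ![Fin.castLE he (finProdFinEquiv.symm c.2).1, 0, 0],
            ![(finProdFinEquiv.symm c.2).2, 0, Fin.castLE hd c.1],
            ![b.1, 0, Fin.castLE hd b.2]] v 1)
        (![![Fin.castLE he (finProdFinEquiv.symm a.2).1, (finProdFinEquiv.symm a.2).2, a.1],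
            ![Fin.castLE he (finProdFinEquiv.symm c.2).1, 0, 0],
            ![(finProdFinEquiv.symm c.2).2, 0, Fin.castLE hd c.1],
            ![b.1, 0, Fin.castLE hd b.2]] v 2) := by
    funext v
    fin_cases v <;> rfl
  rw [hpt, halfTetra_apply_enc]
  simp only [Matrix.cons_val_zero, Matrix.cons_val_one, Matrix.cons_val_two,
    Matrix.head_cons, Matrix.tail_cons, hlt, h1, if_true, one_mul]
  simp only [matMulTensor]
  refine if_congr ?_ rfl rfl
  simp only [consistent_iff, Matrix.cons_val_zero, Matrix.cons_val_one, Matrix.cons_val_two,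
    Matrix.cons_val_three, Matrix.head_cons, Matrix.tail_cons, ecast, e2 a.2 c.2, e3, true_and]
  tauto

/-- **Grouping lower-bound transfer** `R(⟨N, d, eN⟩) ≤ R₄(X_N^{(e,d)})` (`1 ≤ N`, `e, d ≤ N`): a
rank-one decomposition `X = ∑_k ⊗_v u_k(v)` restricts, along the points of `halfTetra_groupPoint`, to
the triad decomposition `⟨N,d,eN⟩ = ∑_k u_k(0) ⊗ u_k(3) ⊗ (u_k(1) u_k(2))`. Christandl–Vrana–Zuiddam
§1.2 (grouping is restriction-monotone; the grouped graph tensor of a triangle-plus-pendant is a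
rectangular matrix multiplication tensor). [cite: ChristandlVranaZuiddam2016, §1.2 (flattening and
grouping lower bounds)] -/
theorem tensorRank_matMulTensor_le_tensorRankD_halfTetra {N e d : ℕ} [NeZero N] (he : e ≤ N)
    (hd : d ≤ N) :
    tensorRank (matMulTensor F N d (e * N)) ≤ tensorRankD (halfTetra F N e d) := by
  classical
  obtain ⟨u, hu⟩ := exists_rankOne_decomposition_halfTetra (F := F) N e d
  refine tensorRank_le_of_eq_sum
    (fun k (a : Fin N × Fin (e * N)) =>
      u k 0 (enc (Fin.castLE he (finProdFinEquiv.symm a.2).1) (finProdFinEquiv.symm a.2).2 a.1))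
    (fun k (b : Fin N × Fin d) => u k 3 (enc b.1 0 (Fin.castLE hd b.2)))
    (fun k (c : Fin d × Fin (e * N)) =>
      u k 1 (enc (Fin.castLE he (finProdFinEquiv.symm c.2).1) 0 0) *
        u k 2 (enc (finProdFinEquiv.symm c.2).2 0 (Fin.castLE hd c.1))) ?_
  funext a b c
  have hpt := congrFun hu
    ![enc (Fin.castLE he (finProdFinEquiv.symm a.2).1) (finProdFinEquiv.symm a.2).2 a.1,
      enc (Fin.castLE he (finProdFinEquiv.symm c.2).1) 0 0,
      enc (finProdFinEquiv.symm c.2).2 0 (Fin.castLE hd c.1),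
      enc b.1 0 (Fin.castLE hd b.2)]
  rw [Finset.sum_apply, halfTetra_groupPoint] at hpt
  rw [← hpt, Finset.sum_apply, Finset.sum_apply, Finset.sum_apply]
  refine Finset.sum_congr rfl fun k _ => ?_
  rw [rankOneTensor_apply, Fin.prod_univ_four, triad_apply]
  simp only [Matrix.cons_val_zero, Matrix.cons_val_one, Matrix.cons_val_two,
    Matrix.cons_val_three, Matrix.head_cons, Matrix.tail_cons]
  ring

/-- **The Lafon–Winograd floor of the half-tensor**: `N·d + d·(eN − 1) + (eN − 1) ≤ R₄(X_N^{(e,d)})`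
for `N ≥ 2`, `1 ≤ d ≤ N`, `1 ≤ e ≤ N`, over every field (grouping + BCS Thm. (17.12) for
`⟨N, d, eN⟩`); at `(2,2,2)` this is `13`. [cite: BurgisserClausenShokrollahi1997, Thm (17.12)] -/
theorem lafonWinograd_le_tensorRankD_halfTetra {N e d : ℕ} [NeZero N] (hN : 2 ≤ N) (he1 : 1 ≤ e)
    (he : e ≤ N) (hd1 : 1 ≤ d) (hd : d ≤ N) :
    N * d + d * (e * N - 1) + (e * N - 1) ≤ tensorRankD (halfTetra F N e d) :=
  (lafonWinograd_le_tensorRank_matMulTensor F (c := N) (m := d) (n := e * N) hN hd1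
      (le_trans he1 (Nat.le_mul_of_pos_right e (by omega)))).trans
    (tensorRank_matMulTensor_le_tensorRankD_halfTetra he hd)

end Grouping

/-! ## §3 The bottom admissible level `(N, e, d) = (2, 2, 2)` -/

section Bottom

variable (F : Type*) [Field F]

/-- **`13 ≤ R₄(X_2^{(2,2)})` over every field**: grouping to `⟨2,2,4⟩` and the PROVED Lafon–Winograd
bound `13 ≤ R(⟨2,2,4⟩)`. [cite: BurgisserClausenShokrollahi1997, Thm (17.12)] -/
theorem thirteen_le_tensorRankD_halfTetra_two : 13 ≤ tensorRankD (halfTetra F 2 2 2) :=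
  (thirteen_le_tensorRank_matMulTensor_224 F).trans
    (tensorRank_matMulTensor_le_tensorRankD_halfTetra (F := F) (N := 2) (e := 2) (d := 2) le_rfl le_rfl)

/-- **`14 ≤ R₄(X_2^{(2,2)})` given Alekseev 2015, Thm 1** (whence `R(⟨2,2,4⟩) = 14`, the exact half of
Alekseev–Smirnov 2013; with Strassen on the triangle `R₄(X_2^{(2,2)}) ≤ 14`, so `= 14`).
[cite: AlekseevSmirnov2013, Thm 1 (zbMATH 1317.68061)] -/
theorem fourteen_le_tensorRankD_halfTetra_two_of_alekseev (K : Type) [Field K]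
    (h : alekseev2015_rank_matMulTensor_m22_ge) : 14 ≤ tensorRankD (halfTetra K 2 2 2) :=
  (alekseevSmirnov2013_tensorRank_matMulTensor_224 K h).symm.le.trans
    (tensorRank_matMulTensor_le_tensorRankD_halfTetra (F := K) (N := 2) (e := 2) (d := 2) le_rfl le_rfl)

/-- At the bottom level the restricted pair is the full tetrahedron: `W_2^{(4)} = T(K₄)_2` (the pendant
bond `e² = 4` saturates at the level `N = 2`), so `R₄(W_2^{(4)}) ≤ 2⁶ = 64`.
[cite: ChristandlVranaZuiddam2016, §1.2 (trivial upper bound)] -/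
theorem tensorRankD_sixTetra_two_four_le : tensorRankD (sixTetra F 2 (2 * 2)) ≤ 64 := by
  rw [sixTetra_of_le (F := F) (show 2 ≤ 2 * 2 by norm_num)]
  simpa using tensorRankD_tetra_le (F := F) 2

/-- **The pairing comparator at the bottom level**: `169 ≤ R₄(X_2^{(2,2)})·R₄(σX_2^{(2,2)})` over every
field (`196 ≤` given Alekseev). [cite: BurgisserClausenShokrollahi1997, Thm (17.12)] -/
theorem comparator_ge_two :
    169 ≤ tensorRankD (halfTetra F 2 2 2) * tensorRankD (halfTetraMirror F 2 2 2) := by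
  have h2 := thirteen_le_tensorRankD_halfTetra_two F
  have h3 : 13 ≤ tensorRankD (halfTetraMirror F 2 2 2) := by
    rw [tensorRankD_halfTetraMirror_eq]; exact h2
  exact (show 169 = 13 * 13 by norm_num).le.trans (Nat.mul_le_mul h2 h3)

/-- The same given Alekseev: `196 ≤ R₄(X)·R₄(σX)` at the bottom level.
[cite: AlekseevSmirnov2013, Thm 1 (zbMATH 1317.68061)] -/
theorem comparator_ge_two_of_alekseev (K : Type) [Field K] (h : alekseev2015_rank_matMulTensor_m22_ge) :
    196 ≤ tensorRankD (halfTetra K 2 2 2) * tensorRankD (halfTetraMirror K 2 2 2) := by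
  have h2 := fourteen_le_tensorRankD_halfTetra_two_of_alekseev K h
  have h3 : 14 ≤ tensorRankD (halfTetraMirror K 2 2 2) := by
    rw [tensorRankD_halfTetraMirror_eq]; exact h2
  exact (show 196 = 14 * 14 by norm_num).le.trans (Nat.mul_le_mul h2 h3)

/-- **Restricted-pair strictness at the bottom admissible level is a theorem**:
`R₄(W_2^{(4)}) ≤ 64 < 169 ≤ R₄(X_2^{(2,2)})·R₄(σX_2^{(2,2)})` — the pairing inequality
`tensorRankD_sixTetra_le_pair` (at `N = e = d = 2`) is strict by a factor `> 2.6` here for the trivial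
reason that the pendant saturates; a constant-level saving carries no exponent. (NODE-g32 §1–2: the
rung needs a saving `~ N^δ` along the square levels.) [cite: ChristandlVranaZuiddam2016, Prop. 1.1.16 (proof)] -/
theorem restrictedPair_strict_two :
    tensorRankD (sixTetra F 2 (2 * 2)) + 105 ≤
      tensorRankD (halfTetra F 2 2 2) * tensorRankD (halfTetraMirror F 2 2 2) := by
  have h1 := tensorRankD_sixTetra_two_four_le F
  have h2 := comparator_ge_two F
  omega

/-- For the record, the pairing itself at this level (an instance of `tensorRankD_sixTetra_le_pair`):
`R₄(W_2^{(4)}) ≤ R₄(X_2^{(2,2)})·R₄(σX_2^{(2,2)})`. [cite: ChristandlVranaZuiddam2016, Prop. 1.1.16 (proof)] -/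
theorem pairing_two :
    tensorRankD (sixTetra F 2 (2 * 2)) ≤
      tensorRankD (halfTetra F 2 2 2) * tensorRankD (halfTetraMirror F 2 2 2) :=
  tensorRankD_sixTetra_le_pair (F := F) le_rfl le_rfl (by norm_num)

end Bottom

end Summit.MatrixMultiplication.MatrixMultiplication.Theorems.EdgePencil

end
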